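import Summits.Parity.GeneralizedHardyLittlewood.Theorems.PrimeLevelFamEdgeMomentsBeyondDiagonalDictionaryAtOneBoxError
import HarnessLib

/-!
# Route `PrimeLevelFamEdge`, crux K_A `MomentsBeyondDiagonal` (stmt-Parity-20007), line «petersson_layers» v4:
# the OFF-BOX weight bound for the `Q = 1` identification (lead prover, 2026-08-28; helper)

For pairs `(n₁,n₂)` outside the AFE box (`n₁n₂ ≥ q²`) the dictionary weight satisfies
`(n₁n₂)^{−1/2} W(n₁n₂/q̂²) · n₁n₂ ≤ 92160 · 12! · q̂⁶ q^{−6} · n₁^{−5/2} n₂^{−5/2}` (`weight_offBox_le`), from the tree's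
`W(y) ≤ 2e^{−√y}`, `√(q²/q̂²)/2 = π√q` and `e^{−π√q} ≤ 12!/(π√q)^{12}`. Elementary; no claim about K_A, GRH or Landau–Siegel.
-/

noncomputable section

open scoped MatrixGroups Real Nat
open CongruenceSubgroup Complex Finset Polynomial MeasureTheory
open Literature.NumberTheory.EllipticCurves.ModularForms
open Literature.NumberTheory.LFunctions

namespace Summit.Parity.GeneralizedHardyLittlewood.Theorems.PrimeLevelFamEdgeIdeaDeltas.PeterssonLayers

/-! ## The off-box weight -/

/-- `√(q²/q̂²)/2 = π√q` (`q̂ = √q/2π`). -/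
theorem sqrt_levelSq_div_qhatSq {q : ℕ} [NeZero q] :
    Real.sqrt (((q : ℝ)) ^ 2 / KMV2000.qhat q ^ 2) / 2 = π * Real.sqrt q := by
  have hq0 : (0 : ℝ) < q := by exact_mod_cast NeZero.pos q
  have hqh : 0 < KMV2000.qhat q := KMV2000.qhat_pos_of_neZero q
  have e1 : ((q : ℝ)) ^ 2 / KMV2000.qhat q ^ 2 = ((q : ℝ) / KMV2000.qhat q) ^ 2 := by rw [div_pow]
  rw [e1, Real.sqrt_sq (by positivity)]
  unfold KMV2000.qhat
  have h : (q : ℝ) / (Real.sqrt q / (2 * π)) = 2 * π * Real.sqrt q := by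
    rw [div_div_eq_mul_div, mul_comm, mul_div_assoc, Real.div_sqrt]
  rw [h]
  ring

/-- `e^{−π√q} ≤ 12! · q^{−6}`. -/
theorem exp_neg_pi_sqrt_le {q : ℕ} [NeZero q] :
    Real.exp (-(π * Real.sqrt q)) ≤ (12 ! : ℝ) * ((q : ℝ)) ^ (-(6 : ℝ)) := by
  have hq0 : (0 : ℝ) < q := by exact_mod_cast NeZero.pos q
  have hs : 0 < Real.sqrt q := Real.sqrt_pos.mpr hq0
  have hx : 0 < π * Real.sqrt q := by positivity
  have h : (π * Real.sqrt q) ^ 12 / (12 ! : ℝ) ≤ Real.exp (π * Real.sqrt q) :=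
    Real.pow_div_factorial_le_exp _ hx.le 12
  have hj : (0 : ℝ) < 12 ! := by exact_mod_cast Nat.factorial_pos 12
  have h1 : Real.exp (-(π * Real.sqrt q)) ≤ (12 ! : ℝ) / (π * Real.sqrt q) ^ 12 := by
    rw [Real.exp_neg, inv_le_comm₀ (Real.exp_pos _) (div_pos hj (pow_pos hx 12)), inv_div]
    exact h
  have h2 : ((q : ℝ)) ^ (6 : ℝ) ≤ (π * Real.sqrt q) ^ 12 := by
    have hpi : Real.sqrt q ≤ π * Real.sqrt q := by
      have := Real.pi_gt_three
      nlinarith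
    calc ((q : ℝ)) ^ (6 : ℝ) = Real.sqrt q ^ 12 := by
          rw [Real.sqrt_eq_rpow, ← Real.rpow_natCast, ← Real.rpow_mul hq0.le]; norm_num
      _ ≤ (π * Real.sqrt q) ^ 12 := pow_le_pow_left₀ hs.le hpi 12
  calc Real.exp (-(π * Real.sqrt q)) ≤ (12 ! : ℝ) / (π * Real.sqrt q) ^ 12 := h1
    _ ≤ (12 ! : ℝ) / ((q : ℝ)) ^ (6 : ℝ) := by gcongr
    _ = (12 ! : ℝ) * ((q : ℝ)) ^ (-(6 : ℝ)) := by rw [Real.rpow_neg hq0.le, div_eq_mul_inv]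

/-- Outside the box (`nᵢ ≥ 1`, not both `≤ q²`): `(n₁n₂)^{−1/2} W(n₁n₂/q̂²) · (n₁n₂) ≤ 92160 · 12! · q̂⁶ q^{−6} · n₁^{−5/2} n₂^{−5/2}`. -/
theorem weight_offBox_le {q : ℕ} [NeZero q] {n₁ n₂ : ℕ} (h₁ : n₁ ≠ 0) (h₂ : n₂ ≠ 0)
    (hout : ((q : ℝ)) ^ 2 ≤ (n₁ : ℝ) * n₂) :
    (((n₁ : ℝ) * n₂) ^ (-(1 / 2 : ℝ))) * KMV2000.cutoffW ((n₁ : ℝ) * n₂ / KMV2000.qhat q ^ 2) *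
        (((n₁ : ℝ) * n₂) ^ (1 : ℝ)) ≤
      92160 * (12 ! : ℝ) * KMV2000.qhat q ^ (6 : ℝ) * ((q : ℝ)) ^ (-(6 : ℝ)) *
        (((n₁ : ℝ)) ^ (-(5 / 2 : ℝ)) * ((n₂ : ℝ)) ^ (-(5 / 2 : ℝ))) := by
  have hqh : 0 < KMV2000.qhat q := KMV2000.qhat_pos_of_neZero q
  have hq0 : (0 : ℝ) < q := by exact_mod_cast NeZero.pos q
  have hn₁ : (0 : ℝ) < n₁ := by exact_mod_cast Nat.pos_of_ne_zero h₁
  have hn₂ : (0 : ℝ) < n₂ := by exact_mod_cast Nat.pos_of_ne_zero h₂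
  have hN : (0 : ℝ) < (n₁ : ℝ) * n₂ := mul_pos hn₁ hn₂
  have hy₀ : 0 < ((q : ℝ)) ^ 2 / KMV2000.qhat q ^ 2 := by positivity
  have hy : ((q : ℝ)) ^ 2 / KMV2000.qhat q ^ 2 ≤ (n₁ : ℝ) * n₂ / KMV2000.qhat q ^ 2 :=
    div_le_div_of_nonneg_right hout (by positivity)
  have hW := cutoffW_le_exp_mul_rpow hy₀ hy 6
  rw [sqrt_levelSq_div_qhatSq] at hW
  have h6 : ((6 ! : ℕ) : ℝ) = 720 := by norm_num [Nat.factorial]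
  have he : (-(((6 : ℕ) : ℝ) / 2)) = (-(3 : ℝ)) := by norm_num
  rw [h6, he] at hW
  have hexp := exp_neg_pi_sqrt_le (q := q)
  have e : ((n₁ : ℝ) * n₂ / KMV2000.qhat q ^ 2) ^ (-(3 : ℝ)) = ((n₁ : ℝ) * n₂) ^ (-(3 : ℝ)) * KMV2000.qhat q ^ (6 : ℝ) := by
    rw [Real.div_rpow hN.le (pow_nonneg hqh.le 2), Real.rpow_neg (pow_nonneg hqh.le 2), div_inv_eq_mul,
      ← Real.rpow_natCast (KMV2000.qhat q) 2, ← Real.rpow_mul hqh.le]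
    norm_num
  rw [e] at hW
  have hW' : KMV2000.cutoffW ((n₁ : ℝ) * n₂ / KMV2000.qhat q ^ 2) ≤
      92160 * ((12 ! : ℝ) * ((q : ℝ)) ^ (-(6 : ℝ))) * (((n₁ : ℝ) * n₂) ^ (-(3 : ℝ)) * KMV2000.qhat q ^ (6 : ℝ)) := by
    calc KMV2000.cutoffW ((n₁ : ℝ) * n₂ / KMV2000.qhat q ^ 2)
        ≤ 2 * (720 : ℝ) * 2 ^ 6 * Real.exp (-(π * Real.sqrt q)) * (((n₁ : ℝ) * n₂) ^ (-(3 : ℝ)) * KMV2000.qhat q ^ (6 : ℝ)) := hW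
      _ ≤ 2 * (720 : ℝ) * 2 ^ 6 * ((12 ! : ℝ) * ((q : ℝ)) ^ (-(6 : ℝ))) * (((n₁ : ℝ) * n₂) ^ (-(3 : ℝ)) * KMV2000.qhat q ^ (6 : ℝ)) := by
          gcongr
      _ = _ := by norm_num
  have e2 : ((n₁ : ℝ) * n₂) ^ (-(1 / 2 : ℝ)) * (((n₁ : ℝ) * n₂) ^ (-(3 : ℝ))) * ((n₁ : ℝ) * n₂) ^ (1 : ℝ) =
      ((n₁ : ℝ)) ^ (-(5 / 2 : ℝ)) * ((n₂ : ℝ)) ^ (-(5 / 2 : ℝ)) := by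
    rw [← Real.rpow_add hN, ← Real.rpow_add hN, ← Real.mul_rpow hn₁.le hn₂.le]; norm_num
  calc (((n₁ : ℝ) * n₂) ^ (-(1 / 2 : ℝ))) * KMV2000.cutoffW ((n₁ : ℝ) * n₂ / KMV2000.qhat q ^ 2) *
        (((n₁ : ℝ) * n₂) ^ (1 : ℝ))
      ≤ (((n₁ : ℝ) * n₂) ^ (-(1 / 2 : ℝ))) *
          (92160 * ((12 ! : ℝ) * ((q : ℝ)) ^ (-(6 : ℝ))) * (((n₁ : ℝ) * n₂) ^ (-(3 : ℝ)) * KMV2000.qhat q ^ (6 : ℝ))) *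
          (((n₁ : ℝ) * n₂) ^ (1 : ℝ)) := by gcongr
    _ = 92160 * (12 ! : ℝ) * KMV2000.qhat q ^ (6 : ℝ) * ((q : ℝ)) ^ (-(6 : ℝ)) *
        (((n₁ : ℝ) * n₂) ^ (-(1 / 2 : ℝ)) * (((n₁ : ℝ) * n₂) ^ (-(3 : ℝ))) * ((n₁ : ℝ) * n₂) ^ (1 : ℝ)) := by ring
    _ = _ := by rw [e2]

end Summit.Parity.GeneralizedHardyLittlewood.Theorems.PrimeLevelFamEdgeIdeaDeltas.PeterssonLayers

end
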